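import Literature.RingTheory.FormalGroups.FormalGroupHomAdd
import HarnessLib

/-!
# The inverse series of a one-dimensional formal group law
# ([Hazewinkel 1978] §1.1 (1.1.4), App. (A.4.7); [Silverman 2009] IV Prop. 2.1 ∕ Lemma 2.4)

Topic `Literature/RingTheory/FormalGroups`; namespace `Literature.RingTheory.FormalGroups`.  DEFINITIONS + fully proved
theorems; no named fact, no instance, no notation, no `sorry`.  Cell `hodgecm-mathlib`, P6 «MOD programme» ROW 4B (sub-desk
F0P6d (G1) «`End F` as a ring»).  Carrier: Mathlib's `FormalGroup R` (whose module docstring promises, but does not construct,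
«a unique power series `i(X)` such that `F(X, i(X)) = 0`»).

## Contents

* §0 `AgreeBelow n u v` — two univariate series have the same coefficients in degrees `< n`; congruence for `+`, `*` (and the
  one-degree GAIN for products of two series without constant term), powers, and for substitution into `F(f, g)`.
* §1 the KEY FORMULA `coeff_succ_formalGroup_subst_add_monomial`: for `g ∈ T·R⟦T⟧`, `n ≥ 1`, `c ∈ R`,
  `(F(T, g + c·Tⁿ))ₙ = (F(T, g))ₙ + c` — since `F(X,Y) ≡ X + Y` modulo `(X,Y)²`.
* §2 `negSeries F : R⟦T⟧` — the inverse series `ι_F(T)`, built degree by degree; `constantCoeff_negSeries = 0`,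
  **`subst_X_negSeries : F(T, ι_F(T)) = 0`**, `coeff_one_negSeries : ι₁ = −1`, and in every currency
  `subst_self_negSeries : F(g, ι_F(g)) = 0`, `subst_negSeries_self : F(ι_F(g), g) = 0` (two-sidedness by the monoid argument in
  Mathlib's `AddMonoid (F.Point σ)`).  [Hazewinkel1978] §1.1 (1.1.4), App. A (A.4.7); [SilvermanAEC2009] IV Prop. 2.1 (d)∕(e).
* uniqueness of inverses in every currency `eq_negSeries_subst_of_subst_eq_zero` (`F(a,b) = 0 ⇒ b = ι_F(a)`).

Deliberately NOT here (sibling `FormalGroupHomNeg`): for a COMMUTATIVE law `ι_G` is an endomorphism, negatives of homomorphisms,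
`Hom_R(F,G)` an abelian group ∕ `End_R(F)` a ring; `ℤ`-module structure `[−n]`, strict isomorphisms ∕ logarithms.
-/

noncomputable section

namespace Literature.RingTheory.FormalGroups

open _root_.MvPowerSeries (HasSubst subst)
open Finset

universe u

variable {R : Type u} [CommRing R]

/-! ## §0 Agreement of univariate series below a degree -/

/-- `u` and `v` have the same coefficients in all degrees `< n`. [cite: BourbakiAlgebraII2003, Ch. IV §4 no. 2] -/
def AgreeBelow (n : ℕ) (u v : PowerSeries R) : Prop :=
  ∀ k < n, PowerSeries.coeff k u = PowerSeries.coeff k v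

namespace AgreeBelow

variable {n : ℕ} {u v u' v' : PowerSeries R}

/-- Reflexivity. [cite: BourbakiAlgebraII2003, Ch. IV §4 no. 2] -/
theorem refl (n : ℕ) (u : PowerSeries R) : AgreeBelow n u u := fun _ _ => rfl

/-- Symmetry. [cite: BourbakiAlgebraII2003, Ch. IV §4 no. 2] -/
theorem symm (h : AgreeBelow n u v) : AgreeBelow n v u := fun k hk => (h k hk).symm

/-- Transitivity. [cite: BourbakiAlgebraII2003, Ch. IV §4 no. 2] -/
theorem trans {w : PowerSeries R} (h : AgreeBelow n u v) (h' : AgreeBelow n v w) : AgreeBelow n u w :=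
  fun k hk => (h k hk).trans (h' k hk)

/-- Monotonicity in the degree. [cite: BourbakiAlgebraII2003, Ch. IV §4 no. 2] -/
theorem mono {m : ℕ} (hmn : m ≤ n) (h : AgreeBelow n u v) : AgreeBelow m u v := fun k hk => h k (lt_of_lt_of_le hk hmn)

/-- Congruence for sums. [cite: BourbakiAlgebraII2003, Ch. IV §4 no. 2] -/
theorem add (h : AgreeBelow n u u') (h' : AgreeBelow n v v') : AgreeBelow n (u + v) (u' + v') := by
  intro k hk; simp [map_add, h k hk, h' k hk]

/-- Congruence for products (coefficient `k` of a product uses coefficients `≤ k` only). [cite: BourbakiAlgebraII2003, Ch. IV §4 no. 2] -/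
theorem mul (h : AgreeBelow n u u') (h' : AgreeBelow n v v') : AgreeBelow n (u * v) (u' * v') := by
  intro k hk
  rw [PowerSeries.coeff_mul, PowerSeries.coeff_mul]
  refine Finset.sum_congr rfl fun p hp => ?_
  have hp' := mem_antidiagonal.mp hp
  rw [h p.1 (by omega), h' p.2 (by omega)]

/-- **One-degree gain**: if `u ≡ u'`, `v ≡ v'` below `n` and all four have zero constant term, then `uv ≡ u'v'` below `n + 1`
(coefficient `n` of `uv` only sees coefficients `1, …, n−1`). [cite: BourbakiAlgebraII2003, Ch. IV §4 no. 2] -/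
theorem mul_gain (h : AgreeBelow n u u') (h' : AgreeBelow n v v') (hu : PowerSeries.constantCoeff u = 0)
    (hu' : PowerSeries.constantCoeff u' = 0) (hv : PowerSeries.constantCoeff v = 0)
    (hv' : PowerSeries.constantCoeff v' = 0) : AgreeBelow (n + 1) (u * v) (u' * v') := by
  intro k hk
  rw [PowerSeries.coeff_mul, PowerSeries.coeff_mul]
  refine Finset.sum_congr rfl fun p hp => ?_
  have hp' := mem_antidiagonal.mp hp
  rcases Nat.eq_zero_or_pos p.1 with h1 | h1
  · rw [h1, PowerSeries.coeff_zero_eq_constantCoeff_apply, PowerSeries.coeff_zero_eq_constantCoeff_apply, hu, hu',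
      zero_mul, zero_mul]
  rcases Nat.eq_zero_or_pos p.2 with h2 | h2
  · rw [h2, PowerSeries.coeff_zero_eq_constantCoeff_apply, PowerSeries.coeff_zero_eq_constantCoeff_apply, hv, hv',
      mul_zero, mul_zero]
  rw [h p.1 (by omega), h' p.2 (by omega)]

/-- Congruence for powers. [cite: BourbakiAlgebraII2003, Ch. IV §4 no. 2] -/
theorem pow (h : AgreeBelow n u u') (m : ℕ) : AgreeBelow n (u ^ m) (u' ^ m) := by
  induction m with
  | zero => simp only [pow_zero]; exact AgreeBelow.refl n 1
  | succ m ih => rw [pow_succ, pow_succ]; exact ih.mul h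

/-- One-degree gain for powers of exponent `≥ 2` of series without constant term. [cite: BourbakiAlgebraII2003, Ch. IV §4 no. 2] -/
theorem pow_gain (h : AgreeBelow n u u') (hu : PowerSeries.constantCoeff u = 0) (hu' : PowerSeries.constantCoeff u' = 0)
    {m : ℕ} (hm : 2 ≤ m) : AgreeBelow (n + 1) (u ^ m) (u' ^ m) := by
  obtain ⟨m, rfl⟩ : ∃ m', m = m' + 2 := ⟨m - 2, by omega⟩
  rw [pow_succ, pow_succ u']
  refine (h.pow (m + 1)).mul_gain h ?_ ?_ hu hu'
  · rw [map_pow, hu, zero_pow (by omega)]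
  · rw [map_pow, hu', zero_pow (by omega)]

end AgreeBelow

/-! ## §1 Substitution `F(f, g)` of univariate series: congruence and the key formula -/

section KeyFormula

variable (F : MvPowerSeries (Fin 2) R)

/-- `MvPowerSeries.coeff (single () n)` on `R⟦T⟧` is `PowerSeries.coeff n` (bookkeeping). [cite: BourbakiAlgebraII2003, Ch. IV §4 no. 2] -/
theorem mvCoeff_single_unit (n : ℕ) (s : PowerSeries R) :
    MvPowerSeries.coeff (Finsupp.single () n) s = PowerSeries.coeff n s := by
  rw [PowerSeries.coeff_def (s := Finsupp.single () n) (by simp)]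

/-- The monomial `f^{d₀} g^{d₁}` of the substitution formula for a pair. [cite: BourbakiAlgebraII2003, Ch. IV §4 no. 3] -/
theorem prod_pair_pow (f g : PowerSeries R) (d : Fin 2 →₀ ℕ) :
    (d.prod fun i e => ((![f, g] : Fin 2 → PowerSeries R) i) ^ e) = f ^ (d 0) * g ^ (d 1) := by
  rw [Finsupp.prod_fintype _ _ (fun _ => pow_zero _)]
  simp [Fin.prod_univ_two]

/-- The substitution formula for `F(f,g)` at a coefficient: `(F(f,g))ₖ = Σ_d F_d · (f^{d₀} g^{d₁})ₖ` (a finite sum).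
[cite: BourbakiAlgebraII2003, Ch. IV §4 no. 3] -/
theorem coeff_subst_pair {f g : PowerSeries R} (hf : PowerSeries.HasSubst f) (hg : PowerSeries.HasSubst g) (k : ℕ) :
    PowerSeries.coeff k (F.subst ![f, g]) =
      ∑ᶠ d : Fin 2 →₀ ℕ, MvPowerSeries.coeff d F • PowerSeries.coeff k (f ^ (d 0) * g ^ (d 1)) := by
  rw [← mvCoeff_single_unit, MvPowerSeries.coeff_subst (hasSubst_pair hf hg)]
  exact finsum_congr fun d => by rw [prod_pair_pow, mvCoeff_single_unit]

/-- The sum in `coeff_subst_pair` is finitely supported. [cite: BourbakiAlgebraII2003, Ch. IV §4 no. 3] -/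
theorem finite_support_coeff_subst_pair {f g : PowerSeries R} (hf : PowerSeries.HasSubst f) (hg : PowerSeries.HasSubst g)
    (k : ℕ) : (Function.support fun d : Fin 2 →₀ ℕ =>
      MvPowerSeries.coeff d F • PowerSeries.coeff k (f ^ (d 0) * g ^ (d 1))).Finite := by
  have h : (Function.support fun d : Fin 2 →₀ ℕ => MvPowerSeries.coeff d F •
      MvPowerSeries.coeff (Finsupp.single () k) (d.prod fun i e => ((![f, g] : Fin 2 → PowerSeries R) i) ^ e)).Finite :=
    MvPowerSeries.coeff_subst_finite (hasSubst_pair hf hg) F (Finsupp.single () k)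
  refine h.subset fun d hd => ?_
  simpa [Function.mem_support, prod_pair_pow, mvCoeff_single_unit] using hd

/-- **Substitution respects agreement below a degree**: if `f ≡ f'`, `g ≡ g'` below `n` (all substitutable) then
`F(f,g) ≡ F(f',g')` below `n`. [cite: BourbakiAlgebraII2003, Ch. IV §4 no. 3] -/
theorem agreeBelow_subst_pair {n : ℕ} {f g f' g' : PowerSeries R} (hf : PowerSeries.HasSubst f) (hg : PowerSeries.HasSubst g)
    (hf' : PowerSeries.HasSubst f') (hg' : PowerSeries.HasSubst g') (hff : AgreeBelow n f f') (hgg : AgreeBelow n g g') :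
    AgreeBelow n (F.subst ![f, g]) (F.subst ![f', g']) := by
  intro k hk
  rw [coeff_subst_pair F hf hg, coeff_subst_pair F hf' hg']
  exact finsum_congr fun d => by rw [((hff.pow (d 0)).mul (hgg.pow (d 1))) k hk]

end KeyFormula

namespace FormalGroupNeg

variable (F : FormalGroup R)

/-- An exponent `d` of `R⟦X,Y⟧` other than `0`, `(1,0)`, `(0,1)` has total degree `≥ 2`. [cite: Hazewinkel1978, §1.1 Def. (1.1.1)] -/
theorem two_le_of_ne {d : Fin 2 →₀ ℕ} (hd0 : d ≠ 0) (hd10 : d ≠ Finsupp.single 0 1) (hd01 : d ≠ Finsupp.single 1 1) :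
    2 ≤ d 0 + d 1 := by
  by_contra hlt
  have hle : d 0 + d 1 ≤ 1 := by omega
  rcases Nat.le_one_iff_eq_zero_or_eq_one.mp hle with h | h
  · exact hd0 (by ext i; fin_cases i <;> simp_all)
  · rcases Nat.add_eq_one_iff.mp h with ⟨h0, h1⟩ | ⟨h0, h1⟩
    · exact hd01 (by ext i; fin_cases i <;> simp [h0, h1])
    · exact hd10 (by ext i; fin_cases i <;> simp [h0, h1])

/-- **Key formula.**  For `g ∈ T·R⟦T⟧`, `n ≥ 1`, `c ∈ R`: replacing `g` by `g + c·Tⁿ` adds exactly `c` to the `n`-th coefficient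
of `F(T, g)`.  (`F(X,Y) ≡ X + Y (mod deg 2)`; every monomial `X^{d₀}Y^{d₁}` with `d₀ + d₁ ≥ 2` contributes to degree `n` only
through `g₁,…,g_{n−1}`.) [cite: Hazewinkel1978, App. A (A.4.7)] -/
theorem coeff_subst_X_add_monomial {g : PowerSeries R} (hg : PowerSeries.constantCoeff g = 0) {n : ℕ} (hn : 1 ≤ n) (c : R) :
    PowerSeries.coeff n (F.toPowerSeries.subst ![PowerSeries.X, g + PowerSeries.monomial n c]) =
      PowerSeries.coeff n (F.toPowerSeries.subst ![PowerSeries.X, g]) + c := by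
  classical
  set g' := g + PowerSeries.monomial n c with hg'def
  have hg'0 : PowerSeries.constantCoeff g' = 0 := by
    rw [hg'def, map_add, hg, zero_add, ← PowerSeries.coeff_zero_eq_constantCoeff_apply, PowerSeries.coeff_monomial,
      if_neg (by omega)]
  have hgs : PowerSeries.HasSubst g := PowerSeries.HasSubst.of_constantCoeff_zero' hg
  have hg's : PowerSeries.HasSubst g' := PowerSeries.HasSubst.of_constantCoeff_zero' hg'0
  have hX : PowerSeries.HasSubst (PowerSeries.X : PowerSeries R) := PowerSeries.HasSubst.X'
  have hagree : AgreeBelow n g' g := by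
    intro k hk
    rw [hg'def, map_add, PowerSeries.coeff_monomial, if_neg (by omega), add_zero]
  -- the terms `T s d := F_d • (X^{d₀} s^{d₁})ₙ` for `s = g, g'`
  have key : ∀ d : Fin 2 →₀ ℕ, d ≠ Finsupp.single 1 1 →
      MvPowerSeries.coeff d F.toPowerSeries • PowerSeries.coeff n (PowerSeries.X ^ (d 0) * g' ^ (d 1)) =
        MvPowerSeries.coeff d F.toPowerSeries • PowerSeries.coeff n (PowerSeries.X ^ (d 0) * g ^ (d 1)) := by
    intro d hd
    by_cases hd0 : d = 0
    · subst hd0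
      have : MvPowerSeries.coeff (0 : Fin 2 →₀ ℕ) F.toPowerSeries = 0 := by simpa using F.zero_constantCoeff
      rw [this, zero_smul, zero_smul]
    by_cases hd10 : d = Finsupp.single 0 1
    · subst hd10; simp
    have h2 := two_le_of_ne hd0 hd10 hd
    congr 1
    rw [PowerSeries.coeff_X_pow_mul', PowerSeries.coeff_X_pow_mul']
    split_ifs with hle
    · rcases Nat.eq_zero_or_pos (d 0) with h0 | h0
      · rw [h0, Nat.sub_zero]
        exact (hagree.pow_gain hg'0 hg (by omega)) n (Nat.lt_succ_self n)
      · exact (hagree.pow (d 1)) (n - d 0) (by omega)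
    · rfl
  have hone : MvPowerSeries.coeff (Finsupp.single 1 1) F.toPowerSeries •
      PowerSeries.coeff n (PowerSeries.X ^ ((Finsupp.single 1 1 : Fin 2 →₀ ℕ) 0) * g' ^ ((Finsupp.single 1 1 : Fin 2 →₀ ℕ) 1)) =
      MvPowerSeries.coeff (Finsupp.single 1 1) F.toPowerSeries •
      PowerSeries.coeff n (PowerSeries.X ^ ((Finsupp.single 1 1 : Fin 2 →₀ ℕ) 0) * g ^ ((Finsupp.single 1 1 : Fin 2 →₀ ℕ) 1)) + c := by
    simp [F.lin_coeff_Y, hg'def]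
  rw [coeff_subst_pair F.toPowerSeries hX hg's, coeff_subst_pair F.toPowerSeries hX hgs]
  have hT : (fun d : Fin 2 →₀ ℕ => MvPowerSeries.coeff d F.toPowerSeries • PowerSeries.coeff n (PowerSeries.X ^ (d 0) * g' ^ (d 1))) =
      fun d => MvPowerSeries.coeff d F.toPowerSeries • PowerSeries.coeff n (PowerSeries.X ^ (d 0) * g ^ (d 1)) +
        (if d = Finsupp.single 1 1 then c else 0) := by
    funext d
    by_cases hd : d = Finsupp.single 1 1
    · rw [if_pos hd, hd]; exact hone
    · rw [if_neg hd, add_zero]; exact key d hd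
  rw [hT, finsum_add_distrib (finite_support_coeff_subst_pair F.toPowerSeries hX hgs n)
    ((Set.finite_singleton (Finsupp.single (1 : Fin 2) 1)).subset fun d hd => by
      by_contra h; exact hd (if_neg h)),
    finsum_eq_single _ (Finsupp.single (1 : Fin 2) 1) (fun d hd => if_neg hd), if_pos rfl]

/-! ## §2 The inverse series `ι_F` by successive approximation -/

/-- The Newton-type iteration `g₀ = 0`, `g_{k+1} = g_k − F(T, g_k)`. [cite: Hazewinkel1978, App. A (A.4.7)] -/
def iter : ℕ → PowerSeries R
  | 0 => 0
  | k + 1 => iter k - F.toPowerSeries.subst ![PowerSeries.X, iter k]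

/-- `iter 0 = 0`. [cite: Hazewinkel1978, App. A (A.4.7)] -/
@[simp] theorem iter_zero : iter F 0 = 0 := rfl

/-- `iter (k+1) = iter k − F(T, iter k)`. [cite: Hazewinkel1978, App. A (A.4.7)] -/
theorem iter_succ (k : ℕ) : iter F (k + 1) = iter F k - F.toPowerSeries.subst ![PowerSeries.X, iter F k] := rfl

/-- `F(T, g)` has zero constant term when `g` has. [cite: Hazewinkel1978, §1.1 Def. (1.1.1)] -/
theorem constantCoeff_subst_X_eq_zero {g : PowerSeries R} (hg : PowerSeries.constantCoeff g = 0) :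
    PowerSeries.constantCoeff (F.toPowerSeries.subst ![PowerSeries.X, g]) = 0 :=
  MvPowerSeries.constantCoeff_subst_eq_zero (hasSubst_pair PowerSeries.HasSubst.X' (PowerSeries.HasSubst.of_constantCoeff_zero' hg))
    (fun i => by fin_cases i; exacts [PowerSeries.constantCoeff_X, hg]) F.zero_constantCoeff

/-- Every iterate has zero constant term. [cite: Hazewinkel1978, App. A (A.4.7)] -/
theorem constantCoeff_iter : ∀ k, PowerSeries.constantCoeff (iter F k) = 0
  | 0 => by simp
  | k + 1 => by rw [iter_succ, map_sub, constantCoeff_iter k, constantCoeff_subst_X_eq_zero F (constantCoeff_iter k), sub_zero]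

/-- Every iterate is substitutable. [cite: Hazewinkel1978, App. A (A.4.7)] -/
theorem hasSubst_iter (k : ℕ) : PowerSeries.HasSubst (iter F k) :=
  PowerSeries.HasSubst.of_constantCoeff_zero' (constantCoeff_iter F k)

/-- **The iterate `g_k` kills `F(T, g_k)` below degree `k + 1`.** [cite: Hazewinkel1978, App. A (A.4.7)] -/
theorem agreeBelow_subst_iter_zero : ∀ k, AgreeBelow (k + 1) (F.toPowerSeries.subst ![PowerSeries.X, iter F k]) 0
  | 0 => by
    intro n hn
    obtain rfl : n = 0 := by omega
    rw [PowerSeries.coeff_zero_eq_constantCoeff_apply, constantCoeff_subst_X_eq_zero F (constantCoeff_iter F 0), map_zero]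
  | k + 1 => by
    have ih := agreeBelow_subst_iter_zero k
    set g := iter F k with hgdef
    set e := F.toPowerSeries.subst ![PowerSeries.X, g] with hedef
    have hg0 : PowerSeries.constantCoeff g = 0 := constantCoeff_iter F k
    have he0 : PowerSeries.constantCoeff e = 0 := constantCoeff_subst_X_eq_zero F hg0
    have hg'0 : PowerSeries.constantCoeff (g - e) = 0 := by rw [map_sub, hg0, he0, sub_zero]
    -- `g - e ≡ g + (-e_{k+1}) T^{k+1}` below `k + 2`
    set c := PowerSeries.coeff (k + 1) e with hcdef
    have hm0 : PowerSeries.constantCoeff (g + PowerSeries.monomial (k + 1) (-c)) = 0 := by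
      rw [map_add, hg0, zero_add, ← PowerSeries.coeff_zero_eq_constantCoeff_apply, PowerSeries.coeff_monomial, if_neg (by omega)]
    have hagree : AgreeBelow (k + 2) (g - e) (g + PowerSeries.monomial (k + 1) (-c)) := by
      intro n hn
      rw [map_sub, map_add, PowerSeries.coeff_monomial]
      rcases Nat.lt_succ_iff_lt_or_eq.mp hn with hlt | heq
      · rw [ih n hlt, map_zero, if_neg (by omega), sub_zero, add_zero]
      · rw [heq, if_pos rfl, ← hcdef, sub_eq_add_neg]
    rw [iter_succ]
    intro n hn
    rw [map_zero, agreeBelow_subst_pair F.toPowerSeries PowerSeries.HasSubst.X' (PowerSeries.HasSubst.of_constantCoeff_zero' hg'0)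
      PowerSeries.HasSubst.X' (PowerSeries.HasSubst.of_constantCoeff_zero' hm0) (AgreeBelow.refl _ _) hagree n hn]
    rcases Nat.lt_succ_iff_lt_or_eq.mp hn with hlt | heq
    · -- below `k + 1`: congruent to `F(T, g)`, which vanishes there
      have hagree' : AgreeBelow (k + 1) (g + PowerSeries.monomial (k + 1) (-c)) g := by
        intro m hm; rw [map_add, PowerSeries.coeff_monomial, if_neg (by omega), add_zero]
      rw [agreeBelow_subst_pair F.toPowerSeries PowerSeries.HasSubst.X' (PowerSeries.HasSubst.of_constantCoeff_zero' hm0)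
        PowerSeries.HasSubst.X' (PowerSeries.HasSubst.of_constantCoeff_zero' hg0) (AgreeBelow.refl _ _) hagree' n hlt, ih n hlt, map_zero]
    · -- at `k + 1`: the key formula
      rw [heq, coeff_subst_X_add_monomial F hg0 (by omega), ← hedef, ← hcdef, add_neg_cancel]

/-- Successive iterates agree below the current precision: `g_k ≡ g_m` below `k + 1` for `k ≤ m`. [cite: Hazewinkel1978, App. A (A.4.7)] -/
theorem agreeBelow_iter {k m : ℕ} (hkm : k ≤ m) : AgreeBelow (k + 1) (iter F k) (iter F m) := by
  induction hkm with
  | refl => exact AgreeBelow.refl _ _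
  | @step m hkm ih =>
    have hkm' : k ≤ m := hkm
    refine ih.trans fun n hn => ?_
    rw [iter_succ, map_sub, (agreeBelow_subst_iter_zero F m) n (by omega), map_zero, sub_zero]

/-- **The inverse series `ι_F(T)`**: the coefficientwise limit of the iterates, `(ι_F)_n := (g_n)_n`; it satisfies
`F(T, ι_F(T)) = 0` (`subst_X_negSeries`). [cite: Hazewinkel1978, §1.1 (1.1.4)] -/
def negSeries : PowerSeries R := PowerSeries.mk fun n => PowerSeries.coeff n (iter F n)

/-- `ι_F ≡ g_m` below `m + 1`. [cite: Hazewinkel1978, App. A (A.4.7)] -/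
theorem agreeBelow_negSeries_iter (m : ℕ) : AgreeBelow (m + 1) (negSeries F) (iter F m) := by
  intro n hn
  rw [negSeries, PowerSeries.coeff_mk]
  exact agreeBelow_iter F (by omega : n ≤ m) n (Nat.lt_succ_self n)

/-- `ι_F(0) = 0`. [cite: Hazewinkel1978, §1.1 (1.1.4)] -/
@[simp] theorem constantCoeff_negSeries : PowerSeries.constantCoeff (negSeries F) = 0 := by
  rw [← PowerSeries.coeff_zero_eq_constantCoeff_apply, negSeries, PowerSeries.coeff_mk, iter_zero, map_zero]

/-- `ι_F` is substitutable. [cite: Hazewinkel1978, §1.1 (1.1.4)] -/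
theorem hasSubst_negSeries : PowerSeries.HasSubst (negSeries F) :=
  PowerSeries.HasSubst.of_constantCoeff_zero' (constantCoeff_negSeries F)

/-- **`F(T, ι_F(T)) = 0`** — `ι_F` is a right inverse of `T`. [cite: Hazewinkel1978, §1.1 (1.1.4)] -/
theorem subst_X_negSeries : F.toPowerSeries.subst ![PowerSeries.X, negSeries F] = 0 := by
  ext n
  rw [map_zero, agreeBelow_subst_pair F.toPowerSeries PowerSeries.HasSubst.X' (hasSubst_negSeries F) PowerSeries.HasSubst.X'
    (hasSubst_iter F n) (AgreeBelow.refl _ _) (agreeBelow_negSeries_iter F n) n (Nat.lt_succ_self n),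
    agreeBelow_subst_iter_zero F n n (Nat.lt_succ_self n), map_zero]

/-- **Right inverse in every currency**: `F(g, ι_F(g)) = 0` for every substitutable `g`. [cite: Hazewinkel1978, §1.1 (1.1.4)] -/
theorem subst_self_negSeries {τ : Type*} {g : MvPowerSeries τ R} (hg : PowerSeries.HasSubst g) :
    F.toPowerSeries.subst ![g, PowerSeries.subst g (negSeries F)] = 0 := by
  have hz : PowerSeries.subst g (0 : PowerSeries R) = 0 := by rw [← PowerSeries.coe_substAlgHom hg, map_zero]
  have h := congrArg (PowerSeries.subst g) (subst_X_negSeries F)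
  rwa [powerSeries_subst_formalGroup_pair F PowerSeries.HasSubst.X' (hasSubst_negSeries F) hg, PowerSeries.subst_X hg, hz] at h

/-- `φ(b)` is substitutable when `φ`, `b` are. [cite: BourbakiAlgebraII2003, Ch. IV §4 no. 3] -/
theorem hasSubst_powerSeries_subst {φ : PowerSeries R} (hφ : PowerSeries.HasSubst φ) {τ : Type*} {b : MvPowerSeries τ R}
    (hb : PowerSeries.HasSubst b) : PowerSeries.HasSubst (PowerSeries.subst b φ) := by
  have h := PowerSeries.HasSubst.comp hφ hb
  rwa [PowerSeries.coe_substAlgHom hb] at h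

/-- **Left inverse in every currency**: `F(ι_F(g), g) = 0` — by the monoid argument: with `y := ι(g)`, `z := ι(y)`,
`g = F(g, F(y,z)) = F(F(g,y), z) = F(0, z) = z`, and `F(y, z) = 0`. [cite: Hazewinkel1978, §1.1 (1.1.4)] -/
theorem subst_negSeries_self {τ : Type*} {g : MvPowerSeries τ R} (hg : PowerSeries.HasSubst g) :
    F.toPowerSeries.subst ![PowerSeries.subst g (negSeries F), g] = 0 := by
  have hys := hasSubst_powerSeries_subst (hasSubst_negSeries F) hg
  have hzs := hasSubst_powerSeries_subst (hasSubst_negSeries F) hys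
  have h1 := subst_self_negSeries F hg
  have h2 := subst_self_negSeries F hys
  have hgz : g = PowerSeries.subst (PowerSeries.subst g (negSeries F)) (negSeries F) :=
    calc g = F.toPowerSeries.subst ![g, 0] := (F.add_zero hg).symm
      _ = F.toPowerSeries.subst ![g, F.toPowerSeries.subst ![PowerSeries.subst g (negSeries F),
            PowerSeries.subst (PowerSeries.subst g (negSeries F)) (negSeries F)]] := by rw [h2]
      _ = F.toPowerSeries.subst ![F.toPowerSeries.subst ![g, PowerSeries.subst g (negSeries F)],
            PowerSeries.subst (PowerSeries.subst g (negSeries F)) (negSeries F)] := (F.assoc' hg hys hzs).symm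
      _ = F.toPowerSeries.subst ![0, PowerSeries.subst (PowerSeries.subst g (negSeries F)) (negSeries F)] := by rw [h1]
      _ = _ := F.zero_add hzs
  have hrw : F.toPowerSeries.subst ![PowerSeries.subst g (negSeries F), g] =
      F.toPowerSeries.subst ![PowerSeries.subst g (negSeries F),
        PowerSeries.subst (PowerSeries.subst g (negSeries F)) (negSeries F)] := by
    rw [← hgz]
  rw [hrw, h2]

/-- **`F(ι_F(T), T) = 0`** — `ι_F` is also a left inverse of `T`. [cite: Hazewinkel1978, §1.1 (1.1.4)] -/
theorem subst_negSeries_X : F.toPowerSeries.subst ![negSeries F, PowerSeries.X] = 0 := by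
  have h := subst_negSeries_self F (PowerSeries.HasSubst.X' (R := R))
  rwa [PowerSeries.X_subst] at h

/-- **Uniqueness of the inverse** (every currency): if `F(a, b) = 0` then `b = ι_F(a)`:
`b = F(F(ι a, a), b) = F(ι a, F(a, b)) = ι a`. [cite: Hazewinkel1978, §1.1 (1.1.4)] -/
theorem eq_negSeries_subst_of_subst_eq_zero {τ : Type*} {a b : MvPowerSeries τ R} (ha : PowerSeries.HasSubst a)
    (hb : PowerSeries.HasSubst b) (h : F.toPowerSeries.subst ![a, b] = 0) : b = PowerSeries.subst a (negSeries F) := by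
  have hys := hasSubst_powerSeries_subst (hasSubst_negSeries F) ha
  calc b = F.toPowerSeries.subst ![0, b] := (F.zero_add hb).symm
    _ = F.toPowerSeries.subst ![F.toPowerSeries.subst ![PowerSeries.subst a (negSeries F), a], b] := by
          rw [subst_negSeries_self F ha]
    _ = F.toPowerSeries.subst ![PowerSeries.subst a (negSeries F), F.toPowerSeries.subst ![a, b]] := F.assoc' hys ha hb
    _ = F.toPowerSeries.subst ![PowerSeries.subst a (negSeries F), 0] := by rw [h]
    _ = _ := F.add_zero hys

/-- **`(ι_F)₁ = −1`**: `ι_F(T) ≡ −T (mod deg 2)` (from `(F(T, ι))₁ = 1 + ι₁ = 0`). [cite: Hazewinkel1978, §1.1 (1.1.4)] -/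
theorem coeff_one_negSeries : PowerSeries.coeff 1 (negSeries F) = -1 := by
  have h := congrArg (PowerSeries.coeff 1) (subst_X_negSeries F)
  rw [FormalGroupHom.coeff_one_formalGroup_subst_pair F PowerSeries.constantCoeff_X (constantCoeff_negSeries F),
    PowerSeries.coeff_one_X, map_zero] at h
  exact (neg_eq_of_add_eq_zero_right h).symm

end FormalGroupNeg

end Literature.RingTheory.FormalGroups
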